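import Mathlib
import HarnessLib
import Literature.Combinatorics.Additive.RaikovKneserCircle

/-!
# Ruzsa's diameter inequality for sumsets of real sets

**Theorem (Ruzsa 1991).** Let `A, B ⊆ ℝ` be bounded sets with `λ(A) ≤ λ(B)` (`λ` = Lebesgue
measure). Then
`λ(A + B) ≥ λ(A) + min(diam B, λ(A) + λ(B))`
[cite: Ruzsa1991] (I. Z. Ruzsa, *Diameter of sets and measure of sumsets*, Monatsh. Math. 112
(1991) 323–328), as printed in [cite: DeRoton2018, §1, p. 178] ("In [Ruz91], Ruzsa improved on the
well-known lower bound `λ(A + B) ≥ λ(A) + λ(B)` and proved that, if `λ(A) ≤ λ(B)`, this can be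
replaced by `λ(A + B) ≥ λ(A) + min(diam(B), λ(A) + λ(B))`") and as display (8) of
[cite: DeRoton2018, §2, Remark 3] ("As noticed by Ruzsa in [Ruz91], when `λ(A) ≤ λ(B)`, (7) also
yields (8)").

Main statement: `volume_add_min_ediam_le_volume_add` — for measurable bounded `A, B ⊆ ℝ`, `A ≠ ∅`,
`volume A ≤ volume B`:
`volume A + min (Metric.ediam B) (volume A + volume B) ≤ volume (A + B)`
(`Metric.ediam B = ENNReal.ofReal (sSup B - sInf B)` is `diam B`; `volume (A + B)` is Mathlib's outer
Lebesgue measure of the sumset, which dominates the inner measure of the sources; the hypothesis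
`A ≠ ∅` is necessary, since for `A = ∅` the left side is `min(diam B, λ(B))`).

## Proof followed

[cite: DeRoton2018, §2, proof of Lemma 1] (Ruzsa's argument, reproduced there with proof):
normalise `b₀ = min B`, `b₀ + D = max B`, `D = diam B`, and for `E ⊆ ℝ` let
`Ẽ_k = {x : #{n : x + nD ∈ E} ≥ k}` be the `k`-th layer of `E` modulo `D` (`RuzsaDiameter.layer`;
we index fibres by `n ∈ ℤ` and all `x ∈ ℝ`, so that `Ẽ_k` is a `D`-periodic subset of `ℝ` whose
image in `ℝ/Dℤ = AddCircle D` has Haar measure `μ(Ẽ_k) = λ(Ẽ_k ∩ (t, t + D])`). Then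
`λ(E) = Σ_{k ≥ 1} μ(Ẽ_k)` (layer cake, `RuzsaDiameter.volume_eq_tsum_volume_image_layer`); for
`S = A + B`: `b₀ + Ã_k ⊆ S̃_{k+1}` since `b₀, b₀ + D ∈ B` (display (3),
`RuzsaDiameter.volume_image_layer_le_succ`) and `Ã_k + B ⊆ S̃_k`, so that Raikov's theorem on the
circle (`addCircle_min_le_volume_add'` of `RaikovKneserCircle`) gives
`min(D, μ(Ã_k) + λ(B)) ≤ μ(S̃_k)` (display (4), `RuzsaDiameter.min_le_volume_image_layer_add`).
With `K = K_A` the number of non-empty layers of `A`: either `μ(S̃_1) = D` and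
`λ(A + B) ≥ D + Σ_{k ≥ 2} μ(S̃_k) ≥ D + λ(A)`, or `μ(S̃_k) ≤ μ(S̃_1) < D` for all `k` and
`λ(A + B) ≥ Σ_{k ≤ K} (μ(Ã_k) + λ(B)) + μ(Ã_K) = λ(A) + K λ(B) + μ(Ã_K)`, which is
`≥ 2λ(A) + λ(B)` (`K = 1`) or `≥ λ(A) + 2λ(B) ≥ 2λ(A) + λ(B)` (`K ≥ 2`, using `λ(A) ≤ λ(B)`)
— `RuzsaDiameter.volume_add_ge_three_cases` (compact sets). General measurable bounded sets by
inner regularity ("the case of general sets can be obtained by applying the result to some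
sequences of closed sets `A_n ⊂ A` and `B_n ⊂ B`", ibid.).

Also here (appended): Ruzsa's lemma with the multiplicity `k = K_A` for compact sets —
`RuzsaDiameter.maxMult` (`K_E = max{k | Ẽ_k ≠ ∅}`) and `RuzsaDiameter.volume_add_ge_maxMult`:
either `λ(A + B) ≥ λ(A) + diam B` or `k λ(A + B) ≥ (k + 1) λ(A) + (k(k+1)/2) λ(B)`
[cite: DeRoton2018, §2, Lemma 1, (1)–(2) and (5)].

And Ruzsa's theorem with the parameters `(K, δ)` for compact sets
(`RuzsaDiameter.volume_add_ge_ratio`: `λ(A)/λ(B) = K(K−1)/2 + Kδ`, `0 ≤ δ < 1` ⟹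
`λ(A + B) ≥ λ(A) + diam B` or `λ(A + B) ≥ λ(A) + (K + δ) λ(B)` [cite: DeRoton2018, §1, Theorem 4]
[cite: DeRoton2018, §2, Theorem 6, (7)], by the minimisation `f(K_A) ≥ f(K)` of
`f(k) = ((k+1)/k) λ(A) + ((k+1)/2) λ(B)`, `RuzsaDiameter.mul_add_le_of_ratio`).

And, for all bounded measurable sets with `λ(A) ≤ λ(B)`, the companion bound with the diameter
of the smaller set, `λ(A + B) ≥ λ(B) + min(diam A, 2λ(A))` (`volume_add_min_ediam_le_volume_add'`,
the case `K' ≥ 2` of [cite: DeRoton2018, §2, proof of Theorem 1 (i)]), whence the two diameter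
bounds of the **continuous `3k − 4` theorem** [cite: DeRoton2018, §1, Theorem 1 (i), first two items]
(`ediam_add_volume_le_of_small_sumset`: `λ(A + B) < λ(A) + λ(B) + min(λ(A), λ(B))` ⟹
`diam A + λ(B) ≤ λ(A + B)` and `diam B + λ(A) ≤ λ(A + B)`), and de Roton's switch lemma
[cite: DeRoton2018, §3, Lemma 2, first item] (`volume_inter_add_volume_inter_le_of_notMem_add`:
`x ∉ A + B` ⟹ `λ([0,x] ∩ A) + λ([0,x] ∩ B) ≤ x`).

Deliberately NOT here: Lemma 1 / Theorem 4 for non-closed sets (the sources work with the inner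
measure and reduce to closed sets), de Roton's improvement of (7) for `diam A / diam B ≤ K`
([cite: DeRoton2018, §2, Theorem 6, second display]), the third item of Theorem 1 (an interval of
length `λ(A) + λ(B)` inside `A + B`, [cite: DeRoton2018, §3]) and its hypothesis (ii), Theorems 2,
3, 5 (structure of extremal sets).
-- TODO(general form): Theorem 4 `(K, δ)` for bounded non-closed sets; Theorem 1 third item.
-/

open MeasureTheory Set Filter Topology
open scoped Pointwise ENNReal

namespace Literature.Combinatorics.Additive

namespace RuzsaDiameter

/-! ### Fibres and layers modulo `D` -/

/-- The fibre of `E ⊆ ℝ` over `x` modulo `D`, indexed by `ℤ`: the integers `m` with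
`x + m • D ∈ E` (de Roton's `#{n ∈ ℕ : x + n D_B ∈ A}`, with `n ∈ ℤ` and any base point `x`)
[cite: DeRoton2018, §2, Lemma 1]. -/
def fiber (E : Set ℝ) (D x : ℝ) : Set ℤ := {m : ℤ | x + m • D ∈ E}

/-- The `k`-th layer of `E` modulo `D`: the reals `x` whose fibre has at least `k` elements
(de Roton's `Ẽ_k = {x ∈ [0,1) : #{n : x + n ∈ E} ≥ k}` [cite: DeRoton2018, §2, proof of Lemma 1],
here as a `D`-periodic subset of `ℝ`). -/
def layer (E : Set ℝ) (D : ℝ) (k : ℕ) : Set ℝ := {x : ℝ | (k : ℕ∞) ≤ (fiber E D x).encard}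

variable {E A B : Set ℝ} {D x : ℝ} {k : ℕ}

/-- Membership in a fibre: `m ∈ fiber E D x ↔ x + m • D ∈ E`
[cite: DeRoton2018, §2, proof of Lemma 1]. -/
lemma mem_fiber {m : ℤ} : m ∈ fiber E D x ↔ x + m • D ∈ E := Iff.rfl

/-- Membership in a layer: `x ∈ Ẽ_k ↔ k ≤ #(fibre of x)` [cite: DeRoton2018, §2, proof of Lemma 1]. -/
lemma mem_layer : x ∈ layer E D k ↔ (k : ℕ∞) ≤ (fiber E D x).encard := Iff.rfl

/-- The `0`-th layer is everything [cite: DeRoton2018, §2, proof of Lemma 1]. -/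
lemma layer_zero : layer E D 0 = univ := by
  ext x; simp [mem_layer]

/-- The layers decrease: `Ẽ_(k+1) ⊆ Ẽ_k` [cite: DeRoton2018, §2, proof of Lemma 1]. -/
lemma layer_antitone : Antitone (layer E D) := by
  intro j k hjk x hx
  rw [mem_layer] at hx ⊢
  exact le_trans (by exact_mod_cast hjk) hx

/-- Layers are monotone in the set [cite: DeRoton2018, §2, proof of Lemma 1]. -/
lemma layer_mono (h : A ⊆ B) : layer A D k ⊆ layer B D k := by
  intro x hx
  rw [mem_layer] at hx ⊢
  exact hx.trans (encard_le_encard fun m hm => h hm)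

/-- A non-empty set has a non-empty first layer (`K_E ≥ 1`)
[cite: DeRoton2018, §2, proof of Lemma 1]. -/
lemma layer_one_nonempty (hE : E.Nonempty) : (layer E D 1).Nonempty := by
  obtain ⟨x, hx⟩ := hE
  refine ⟨x, ?_⟩
  rw [mem_layer, Nat.cast_one, one_le_encard_iff_nonempty]
  exact ⟨0, by simp [mem_fiber, hx]⟩

/-- Points of `Ẽ_k`, `k ≥ 1`, have non-empty fibres [cite: DeRoton2018, §2, proof of Lemma 1]. -/
lemma fiber_nonempty_of_mem_layer (hk : 1 ≤ k) (hx : x ∈ layer E D k) : (fiber E D x).Nonempty := by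
  rw [← one_le_encard_iff_nonempty]
  exact le_trans (by exact_mod_cast hk) hx

/-- Shifting the base point by `j • D` shifts the fibre by `j` [cite: DeRoton2018, §2, proof of Lemma 1]. -/
lemma fiber_add_zsmul (j : ℤ) : fiber E D (x + j • D) = (fun m => m + j) ⁻¹' fiber E D x := by
  ext m
  simp only [mem_fiber, mem_preimage, zsmul_eq_mul, Int.cast_add]
  rw [show x + ((m : ℝ) + j) * D = x + j * D + m * D by ring]

/-- The fibre count is `D`-periodic [cite: DeRoton2018, §2, proof of Lemma 1]. -/
lemma encard_fiber_add_zsmul (j : ℤ) :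
    (fiber E D (x + j • D)).encard = (fiber E D x).encard := by
  rw [fiber_add_zsmul]
  exact encard_preimage_of_injective_subset_range (add_left_injective j)
    (fun m _ => ⟨m - j, by simp⟩)

/-- The layers are `D`-periodic [cite: DeRoton2018, §2, proof of Lemma 1]. -/
lemma add_zsmul_mem_layer (j : ℤ) : x + j • D ∈ layer E D k ↔ x ∈ layer E D k := by
  rw [mem_layer, mem_layer, encard_fiber_add_zsmul]

/-- `Ã_k + B ⊆ S̃_k` for `S = A + B` [cite: DeRoton2018, §2, proof of Lemma 1, (4)]. -/
lemma add_mem_layer_add (hx : x ∈ layer A D k) {b : ℝ} (hb : b ∈ B) :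
    x + b ∈ layer (A + B) D k := by
  rw [mem_layer] at hx ⊢
  refine hx.trans (encard_le_encard fun m hm => ?_)
  rw [mem_fiber] at hm ⊢
  exact Set.mem_add.mpr ⟨x + m • D, hm, b, hb, by ring⟩

/-- `Ã_k + B ⊆ S̃_k` for `S = A + B`, set form [cite: DeRoton2018, §2, proof of Lemma 1]. -/
lemma layer_add_subset : layer A D k + B ⊆ layer (A + B) D k := by
  rintro _ ⟨x, hx, b, hb, rfl⟩
  exact add_mem_layer_add hx hb

/-- `Ã_{k-1} ⊆ S̃_k` when `0, D_B ∈ B` (here: `b₀, b₀ + D ∈ B`, and the inclusion is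
`b₀ + Ã_k ⊆ S̃_{k+1}`) [cite: DeRoton2018, §2, proof of Lemma 1, (3)]. -/
lemma add_mem_layer_add_succ (hk : 1 ≤ k) (hx : x ∈ layer A D k) {b₀ : ℝ} (hb₀ : b₀ ∈ B)
    (hb₁ : b₀ + D ∈ B) : x + b₀ ∈ layer (A + B) D (k + 1) := by
  have hF₀ : fiber A D x ⊆ fiber (A + B) D (x + b₀) := fun m hm =>
    Set.mem_add.mpr ⟨x + m • D, hm, b₀, hb₀, by ring⟩
  have hF₁ : (fun m => m - 1) ⁻¹' fiber A D x ⊆ fiber (A + B) D (x + b₀) := fun m hm =>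
    Set.mem_add.mpr ⟨x + (m - 1) • D, hm, b₀ + D, hb₁, by rw [sub_zsmul, one_zsmul]; ring⟩
  rw [mem_layer] at hx ⊢
  rcases (fiber A D x).finite_or_infinite with hfin | hinf
  · have hne : (fiber A D x).Nonempty := fiber_nonempty_of_mem_layer hk hx
    obtain ⟨M, hM, hMmax⟩ := hfin.exists_maximal hne
    have hnot : M + 1 ∉ fiber A D x := fun h => by
      have := hMmax h (by linarith)
      linarith
    have hins : insert (M + 1) (fiber A D x) ⊆ fiber (A + B) D (x + b₀) := by
      rintro m (rfl | hm)
      · exact hF₁ (by simpa using hM)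
      · exact hF₀ hm
    calc ((k + 1 : ℕ) : ℕ∞) = (k : ℕ∞) + 1 := by push_cast; rfl
      _ ≤ (fiber A D x).encard + 1 := add_le_add hx le_rfl
      _ = (insert (M + 1) (fiber A D x)).encard := (encard_insert_of_notMem hnot).symm
      _ ≤ _ := encard_le_encard hins
  · have : (fiber (A + B) D (x + b₀)).encard = ⊤ :=
      encard_eq_top_iff.mpr (hinf.mono hF₀)
    rw [this]; exact le_top

/-- For `E ⊆ [-R, R]` and `D > 0` every fibre has at most `⌊2R/D⌋₊ + 1` elements. [folklore] -/
private lemma encard_fiber_le {R : ℝ} (hE : E ⊆ Icc (-R) R) (hD : 0 < D) (x : ℝ) :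
    (fiber E D x).encard ≤ ((⌊2 * R / D⌋₊ + 1 : ℕ) : ℕ∞) := by
  have hsub : fiber E D x ⊆ (Finset.Icc ⌈(-R - x) / D⌉ ⌊(R - x) / D⌋ : Set ℤ) := by
    intro m hm
    have h := hE hm
    simp only [mem_Icc] at h
    simp only [Finset.coe_Icc, mem_Icc]
    constructor
    · refine Int.ceil_le.mpr ?_
      rw [div_le_iff₀ hD]
      have : (m : ℝ) * D = m • D := by simp [zsmul_eq_mul]
      linarith [h.1]
    · refine Int.le_floor.mpr ?_
      rw [le_div_iff₀ hD]
      have : (m : ℝ) * D = m • D := by simp [zsmul_eq_mul]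
      linarith [h.2]
  refine (encard_le_encard hsub).trans ?_
  rw [encard_coe_eq_coe_finsetCard, Int.card_Icc, Nat.cast_le]
  have h1 : (⌈(-R - x) / D⌉ : ℝ) ≥ (-R - x) / D := Int.le_ceil _
  have h2 : (⌊(R - x) / D⌋ : ℝ) ≤ (R - x) / D := Int.floor_le _
  have h3 : ((⌊(R - x) / D⌋ + 1 - ⌈(-R - x) / D⌉ : ℤ) : ℝ) ≤ 2 * R / D + 1 := by
    push_cast
    have : (R - x) / D - (-R - x) / D = 2 * R / D := by field_simp; ring
    linarith
  by_cases hneg : ⌊(R - x) / D⌋ + 1 - ⌈(-R - x) / D⌉ ≤ 0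
  · rw [Int.toNat_of_nonpos hneg]; exact Nat.zero_le _
  · rw [not_le] at hneg
    have h4 : ((⌊(R - x) / D⌋ + 1 - ⌈(-R - x) / D⌉).toNat : ℤ) = ⌊(R - x) / D⌋ + 1 - ⌈(-R - x) / D⌉ :=
      Int.toNat_of_nonneg hneg.le
    have h5 : ((⌊(R - x) / D⌋ + 1 - ⌈(-R - x) / D⌉).toNat : ℝ) ≤ 2 * R / D + 1 := by
      have : ((⌊(R - x) / D⌋ + 1 - ⌈(-R - x) / D⌉).toNat : ℝ)
          = (((⌊(R - x) / D⌋ + 1 - ⌈(-R - x) / D⌉).toNat : ℤ) : ℝ) := by norm_cast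
      rw [this, h4]; exact h3
    have h6 : (2 * R / D : ℝ) < ⌊2 * R / D⌋₊ + 1 := Nat.lt_floor_add_one _
    have h7 : ((⌊(R - x) / D⌋ + 1 - ⌈(-R - x) / D⌉).toNat : ℝ) < (⌊2 * R / D⌋₊ + 1 : ℕ) + 1 := by
      push_cast; linarith
    exact_mod_cast Nat.lt_add_one_iff.mp (by exact_mod_cast h7)

/-- For `E ⊆ [-R, R]` the layer of index `⌊2R/D⌋₊ + 2` is empty. [folklore] -/
private lemma layer_eq_empty_of_subset_Icc {R : ℝ} (hE : E ⊆ Icc (-R) R) (hD : 0 < D) :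
    layer E D (⌊2 * R / D⌋₊ + 2) = ∅ := by
  ext x
  simp only [mem_layer, mem_empty_iff_false, iff_false, not_le]
  refine lt_of_le_of_lt (encard_fiber_le hE hD x) ?_
  exact_mod_cast Nat.lt_succ_self _

/-! ### Measurability and the layer-cake formula -/

/-- The fibre count as an `ℝ≥0∞`-valued series of indicators. [folklore] -/
private lemma encard_fiber_eq_tsum (x : ℝ) :
    ((fiber E D x).encard : ℝ≥0∞) = ∑' m : ℤ, ((fun y => y + m • D) ⁻¹' E).indicator 1 x := by
  rw [← ENNReal.tsum_set_one, tsum_subtype (fiber E D x) (fun _ => (1 : ℝ≥0∞))]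
  refine tsum_congr fun m => ?_
  by_cases h : x + m • D ∈ E
  · rw [indicator_of_mem (show m ∈ fiber E D x from h), indicator_of_mem (show x ∈ _ from h)]
    rfl
  · rw [indicator_of_notMem (show m ∉ fiber E D x from h),
      indicator_of_notMem (show x ∉ (fun y => y + m • D) ⁻¹' E from h)]

/-- The fibre count is a measurable function of the base point. [folklore] -/
private lemma measurable_encard_fiber (hE : MeasurableSet E) :
    Measurable fun x => ((fiber E D x).encard : ℝ≥0∞) := by
  simp_rw [encard_fiber_eq_tsum, ENNReal.tsum_eq_iSup_sum]
  refine Measurable.iSup fun s => Finset.measurable_sum s fun m _ => ?_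
  exact measurable_one.indicator (hE.preimage (measurable_id.add_const _))

/-- The layer as a preimage under the (`ℝ≥0∞`-valued) fibre count. [folklore] -/
private lemma layer_eq_preimage :
    layer E D k = (fun x => ((fiber E D x).encard : ℝ≥0∞)) ⁻¹' Ici (k : ℝ≥0∞) := by
  ext x
  simp only [mem_layer, mem_preimage, mem_Ici]
  rw [← ENat.toENNReal_coe, ENat.toENNReal_le]

/-- The layers of a measurable set are measurable [cite: DeRoton2018, §2, proof of Lemma 1]. -/
lemma measurableSet_layer (hE : MeasurableSet E) : MeasurableSet (layer E D k) := by
  rw [layer_eq_preimage]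
  exact measurable_encard_fiber hE measurableSet_Ici


/-- An extended natural number as a series of indicators: `m = Σ_{k ≥ 0} [k + 1 ≤ m]`.
[folklore] -/
private lemma toENNReal_eq_tsum_ite (m : ℕ∞) :
    (m : ℝ≥0∞) = ∑' k : ℕ, if (k + 1 : ℕ∞) ≤ m then (1 : ℝ≥0∞) else 0 := by
  induction m using ENat.recTopCoe with
  | top =>
    simp only [le_top, if_true, ENat.toENNReal_top]
    exact (ENNReal.tsum_const_eq_top_of_ne_zero one_ne_zero).symm
  | coe n =>
    rw [ENat.toENNReal_coe, tsum_eq_sum (s := Finset.range n) (fun k hk => ?_)]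
    · rw [Finset.sum_congr rfl (g := fun _ => (1 : ℝ≥0∞)) (fun k hk => ?_)]
      · simp
      · rw [Finset.mem_range] at hk
        rw [if_pos]
        exact_mod_cast hk
    · rw [Finset.mem_range, not_lt] at hk
      rw [if_neg]
      have : ¬ (k + 1 ≤ n) := by omega
      exact_mod_cast this

/-- **Layer-cake formula**: `λ(E) = Σ_{k ≥ 1} λ(Ẽ_k ∩ (0, D])`
(`λ(A) = Σ_k μ(Ã_k)` there)
[cite: DeRoton2018, §2, proof of Lemma 1]. -/
lemma volume_eq_tsum_layer (hE : MeasurableSet E) (hD : 0 < D) :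
    volume E = ∑' k : ℕ, volume (layer E D (k + 1) ∩ Ioc 0 D) := by
  have hmeas : ∀ n : ℤ, MeasurableSet ((fun y => y + n • D) ⁻¹' E) := fun n =>
    hE.preimage (measurable_id.add_const _)
  have hcover : E = ⋃ n : ℤ, E ∩ Ioc (n • D) ((n + 1) • D) := by
    rw [← inter_iUnion]
    have h := iUnion_Ioc_add_zsmul hD (0 : ℝ)
    simp only [zero_add] at h
    rw [h, inter_univ]
  have hdisj : Pairwise (Function.onFun Disjoint fun n : ℤ => E ∩ Ioc (n • D) ((n + 1) • D)) := by
    have h := pairwise_disjoint_Ioc_add_zsmul (0 : ℝ) D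
    simp only [zero_add] at h
    exact h.mono fun i j hij => hij.mono inter_subset_right inter_subset_right
  calc volume E = ∑' n : ℤ, volume (E ∩ Ioc (n • D) ((n + 1) • D)) := by
        conv_lhs => rw [hcover]
        exact measure_iUnion hdisj fun n => hE.inter measurableSet_Ioc
    _ = ∑' n : ℤ, volume (((fun y => y + n • D) ⁻¹' E) ∩ Ioc 0 D) := by
        refine tsum_congr fun n => ?_
        rw [← measure_preimage_add_right volume (n • D) (E ∩ Ioc (n • D) ((n + 1) • D))]
        congr 1
        ext y
        simp only [mem_preimage, mem_inter_iff, mem_Ioc, add_zsmul, one_zsmul]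
        constructor
        · rintro ⟨h1, h2, h3⟩; exact ⟨h1, by linarith, by linarith⟩
        · rintro ⟨h1, h2, h3⟩; exact ⟨h1, by linarith, by linarith⟩
    _ = ∑' n : ℤ, ∫⁻ x in Ioc 0 D, ((fun y => y + n • D) ⁻¹' E).indicator 1 x := by
        refine tsum_congr fun n => ?_
        rw [lintegral_indicator_one (hmeas n), Measure.restrict_apply (hmeas n)]
    _ = ∫⁻ x in Ioc 0 D, ∑' n : ℤ, ((fun y => y + n • D) ⁻¹' E).indicator 1 x :=
        (lintegral_tsum fun n => (measurable_one.indicator (hmeas n)).aemeasurable).symm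
    _ = ∫⁻ x in Ioc 0 D, ((fiber E D x).encard : ℝ≥0∞) :=
        lintegral_congr fun x => (encard_fiber_eq_tsum x).symm
    _ = ∫⁻ x in Ioc 0 D, ∑' k : ℕ, (layer E D (k + 1)).indicator 1 x := by
        refine lintegral_congr fun x => ?_
        rw [toENNReal_eq_tsum_ite]
        refine tsum_congr fun k => ?_
        by_cases h : x ∈ layer E D (k + 1)
        · rw [indicator_of_mem h, Pi.one_apply, if_pos]
          rw [mem_layer] at h
          exact_mod_cast h
        · rw [indicator_of_notMem h, if_neg]
          rw [mem_layer] at h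
          exact_mod_cast h
    _ = ∑' k : ℕ, ∫⁻ x in Ioc 0 D, (layer E D (k + 1)).indicator 1 x :=
        lintegral_tsum fun k => (measurable_one.indicator (measurableSet_layer hE)).aemeasurable
    _ = ∑' k : ℕ, volume (layer E D (k + 1) ∩ Ioc 0 D) := by
        refine tsum_congr fun k => ?_
        rw [lintegral_indicator_one (measurableSet_layer hE),
          Measure.restrict_apply (measurableSet_layer hE)]

/-! ### Transfer to the circle `ℝ/Dℤ = AddCircle D` -/

section Circle

/-- Two reals have the same image in `ℝ/Dℤ` iff they differ by an integer multiple of `D`.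
[folklore] -/
private lemma coe_eq_coe_iff_exists_zsmul {x y : ℝ} :
    (x : AddCircle D) = (y : AddCircle D) ↔ ∃ m : ℤ, x = y + m • D := by
  rw [← sub_eq_zero, ← AddCircle.coe_sub, AddCircle.coe_eq_zero_iff]
  constructor
  · rintro ⟨m, hm⟩; exact ⟨m, by linarith⟩
  · rintro ⟨m, hm⟩; exact ⟨m, by linarith⟩

/-- The saturation of `E ⊆ ℝ` under `Dℤ`. [folklore] -/
private lemma preimage_image_coe (E : Set ℝ) :
    ((↑) : ℝ → AddCircle D) ⁻¹' (((↑) : ℝ → AddCircle D) '' E)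
      = ⋃ m : ℤ, (fun y => y + m • D) ⁻¹' E := by
  ext y
  simp only [mem_preimage, mem_image, mem_iUnion]
  constructor
  · rintro ⟨e, he, hey⟩
    obtain ⟨m, hm⟩ := coe_eq_coe_iff_exists_zsmul.mp hey
    exact ⟨m, by rw [← hm]; exact he⟩
  · rintro ⟨m, hm⟩
    exact ⟨y + m • D, hm, coe_eq_coe_iff_exists_zsmul.mpr ⟨m, rfl⟩⟩

/-- Layers are saturated under `Dℤ`. [folklore] -/
private lemma iUnion_preimage_add_zsmul_layer :
    (⋃ m : ℤ, (fun y => y + m • D) ⁻¹' layer E D k) = layer E D k := by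
  ext y
  simp only [mem_iUnion, mem_preimage, add_zsmul_mem_layer]
  exact ⟨fun ⟨_, h⟩ => h, fun h => ⟨0, h⟩⟩

variable [hD : Fact (0 < D)]


/-- The projection of a measurable subset of `ℝ` is measurable in `ℝ/Dℤ`. [folklore] -/
private lemma measurableSet_image_coe (hE : MeasurableSet E) :
    MeasurableSet (((↑) : ℝ → AddCircle D) '' E) := by
  have hpre : MeasurableSet (((↑) : ℝ → AddCircle D) ⁻¹' (((↑) : ℝ → AddCircle D) '' E)) := by
    rw [preimage_image_coe]
    exact MeasurableSet.iUnion fun m => hE.preimage (measurable_id.add_const _)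
  have key : ((↑) : ℝ → AddCircle D) '' E
      = (fun z : AddCircle D => ((AddCircle.equivIco D 0 z : ℝ))) ⁻¹'
          (((↑) : ℝ → AddCircle D) ⁻¹' (((↑) : ℝ → AddCircle D) '' E)) := by
    ext z
    rw [mem_preimage, mem_preimage, AddCircle.coe_equivIco]
  rw [key]
  exact (measurable_subtype_coe.comp (AddCircle.measurableEquivIco D 0).measurable) hpre

/-- Haar measure of a projection = Lebesgue measure of the saturation in a period window.
[folklore] -/
private lemma volume_image_coe (hE : MeasurableSet E) (t : ℝ) :
    volume (((↑) : ℝ → AddCircle D) '' E)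
      = volume ((⋃ m : ℤ, (fun y => y + m • D) ⁻¹' E) ∩ Ioc t (t + D)) := by
  rw [AddCircle.add_projection_respects_measure (T := D) t (measurableSet_image_coe hE)]
  show volume (((↑) : ℝ → AddCircle D) ⁻¹' (((↑) : ℝ → AddCircle D) '' E) ∩ Ioc t (t + D)) = _
  rw [preimage_image_coe]

/-- `μ(Ẽ_k) = λ(Ẽ_k ∩ (t, t + D])` for every period window [cite: DeRoton2018, §2, proof of Lemma 1]. -/
lemma volume_image_coe_layer (hE : MeasurableSet E) (t : ℝ) :
    volume (((↑) : ℝ → AddCircle D) '' layer E D k) = volume (layer E D k ∩ Ioc t (t + D)) := by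
  rw [volume_image_coe (measurableSet_layer hE) t, iUnion_preimage_add_zsmul_layer]

/-- The layer-cake formula on the circle: `λ(E) = Σ_(k ≥ 1) μ(Ẽ_k)`
[cite: DeRoton2018, §2, proof of Lemma 1]. -/
lemma volume_eq_tsum_volume_image_layer (hE : MeasurableSet E) :
    volume E = ∑' k : ℕ, volume (((↑) : ℝ → AddCircle D) '' layer E D (k + 1)) := by
  rw [volume_eq_tsum_layer hE hD.out]
  refine tsum_congr fun k => ?_
  rw [volume_image_coe_layer hE 0, zero_add]

/-- A measurable `B` inside one closed period `[b₀, b₀ + D]` loses no mass under projection.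
[folklore] -/
private lemma volume_le_volume_image_coe (hB : MeasurableSet B) {b₀ : ℝ} (hBsub : B ⊆ Icc b₀ (b₀ + D)) :
    volume B ≤ volume (((↑) : ℝ → AddCircle D) '' B) := by
  rw [volume_image_coe hB b₀]
  have hsub : B ⊆ (B ∩ Ioc b₀ (b₀ + D)) ∪ {b₀} := by
    intro y hy
    have h := hBsub hy
    by_cases hyb : y = b₀
    · exact Or.inr hyb
    · exact Or.inl ⟨hy, lt_of_le_of_ne h.1 (Ne.symm hyb), h.2⟩
  have hsub2 : B ∩ Ioc b₀ (b₀ + D) ⊆ (⋃ m : ℤ, (fun y => y + m • D) ⁻¹' B) ∩ Ioc b₀ (b₀ + D) := by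
    refine inter_subset_inter_left _ fun y hy => mem_iUnion.mpr ⟨0, ?_⟩
    simpa using hy
  calc volume B ≤ volume ((B ∩ Ioc b₀ (b₀ + D)) ∪ {b₀}) := measure_mono hsub
    _ ≤ volume (B ∩ Ioc b₀ (b₀ + D)) + volume ({b₀} : Set ℝ) := measure_union_le _ _
    _ = volume (B ∩ Ioc b₀ (b₀ + D)) := by rw [Real.volume_singleton, add_zero]
    _ ≤ _ := measure_mono hsub2

/-- Raikov's theorem on `ℝ/Dℤ`, transferred: `min(D, μ(Ã_k) + λ(B)) ≤ μ(S̃_k)`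
[cite: DeRoton2018, §2, proof of Lemma 1, (4)] [cite: Raikov1939]. -/
lemma min_le_volume_image_layer_add (hA : MeasurableSet A) (hB : MeasurableSet B)
    (hBne : B.Nonempty) {b₀ : ℝ} (hBsub : B ⊆ Icc b₀ (b₀ + D)) (hne : (layer A D k).Nonempty) :
    min (ENNReal.ofReal D) (volume (((↑) : ℝ → AddCircle D) '' layer A D k) + volume B)
      ≤ volume (((↑) : ℝ → AddCircle D) '' layer (A + B) D k) := by
  have h1 := addCircle_min_le_volume_add' (T := D)
    (measurableSet_image_coe (measurableSet_layer hA)) (measurableSet_image_coe hB)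
    (hne.image _) (hBne.image _)
  have h2 : ((↑) : ℝ → AddCircle D) '' layer A D k + ((↑) : ℝ → AddCircle D) '' B
      ⊆ ((↑) : ℝ → AddCircle D) '' layer (A + B) D k := by
    rintro _ ⟨_, ⟨x, hx, rfl⟩, _, ⟨b, hb, rfl⟩, rfl⟩
    exact ⟨x + b, add_mem_layer_add hx hb, by simp only [AddCircle.coe_add]⟩
  calc min (ENNReal.ofReal D) (volume (((↑) : ℝ → AddCircle D) '' layer A D k) + volume B)
      ≤ min (ENNReal.ofReal D) (volume (((↑) : ℝ → AddCircle D) '' layer A D k)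
          + volume (((↑) : ℝ → AddCircle D) '' B)) :=
        min_le_min le_rfl (add_le_add le_rfl (volume_le_volume_image_coe hB hBsub))
    _ ≤ volume (((↑) : ℝ → AddCircle D) '' layer A D k + ((↑) : ℝ → AddCircle D) '' B) := h1
    _ ≤ _ := measure_mono h2

/-- `μ(Ã_k) ≤ μ(S̃_{k+1})` when `b₀, b₀ + D ∈ B` [cite: DeRoton2018, §2, proof of Lemma 1, (3)]. -/
lemma volume_image_layer_le_succ (hk : 1 ≤ k) {b₀ : ℝ} (hb₀ : b₀ ∈ B)
    (hb₁ : b₀ + D ∈ B) :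
    volume (((↑) : ℝ → AddCircle D) '' layer A D k)
      ≤ volume (((↑) : ℝ → AddCircle D) '' layer (A + B) D (k + 1)) := by
  have h : ((b₀ : ℝ) : AddCircle D) +ᵥ (((↑) : ℝ → AddCircle D) '' layer A D k)
      ⊆ ((↑) : ℝ → AddCircle D) '' layer (A + B) D (k + 1) := by
    rintro _ ⟨_, ⟨x, hx, rfl⟩, rfl⟩
    refine ⟨x + b₀, add_mem_layer_add_succ hk hx hb₀ hb₁, ?_⟩
    show ((x + b₀ : ℝ) : AddCircle D) = (b₀ : AddCircle D) + (x : AddCircle D)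
    rw [AddCircle.coe_add, add_comm]
  calc volume (((↑) : ℝ → AddCircle D) '' layer A D k)
      = volume (((b₀ : ℝ) : AddCircle D) +ᵥ (((↑) : ℝ → AddCircle D) '' layer A D k)) :=
        (measure_vadd _ _ _).symm
    _ ≤ _ := measure_mono h

end Circle

/-! ### Ruzsa's lemma for compact sets -/

section Core

variable [hD : Fact (0 < D)]

/-- A bounded set has an empty layer. [folklore] -/
private lemma exists_layer_eq_empty (hA : Bornology.IsBounded A) : ∃ N : ℕ, layer A D N = ∅ := by
  obtain ⟨R, hR⟩ := hA.subset_closedBall (0 : ℝ)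
  rw [Real.closedBall_eq_Icc, zero_sub, zero_add] at hR
  exact ⟨_, layer_eq_empty_of_subset_Icc hR hD.out⟩

/-- **Ruzsa's lemma, in the form needed for the diameter inequality** (compact sets; `B`
normalised so that `b₀ = min B`, `b₀ + D = max B`, `D = diam B > 0`). With `Ã_k`, `S̃_k` the
layers of `A` and `S = A + B` modulo `D` and `K = K_A` the number of non-empty layers of `A`:
`λ(A) = Σ_{k ≤ K} μ(Ã_k)`, `λ(A + B) ≥ Σ_{k ≤ K + 1} μ(S̃_k)`, `μ(Ã_{k-1}) ≤ μ(S̃_k)` (3) and, by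
Raikov's theorem, `min(D, μ(Ã_k) + λ(B)) ≤ μ(S̃_k)` (4); hence either `μ(S̃_1) = D` and
`λ(A + B) ≥ λ(A) + D`, or `λ(A + B) ≥ Σ_{k ≤ K} (μ(Ã_k) + λ(B)) + μ(Ã_K) = λ(A) + K λ(B) + μ(Ã_K)`,
which is `≥ 2 λ(A) + λ(B)` for `K = 1` and `≥ λ(A) + 2 λ(B)` for `K ≥ 2`
[cite: DeRoton2018, §2, proof of Lemma 1, (3)–(5)] [cite: Ruzsa1991]. -/
theorem volume_add_ge_three_cases (hA : IsCompact A) (hAne : A.Nonempty) (hB : IsCompact B)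
    {b₀ : ℝ} (hb₀ : b₀ ∈ B) (hb₁ : b₀ + D ∈ B) (hBsub : B ⊆ Icc b₀ (b₀ + D)) :
    volume A + ENNReal.ofReal D ≤ volume (A + B) ∨
      2 * volume A + volume B ≤ volume (A + B) ∨
      volume A + 2 * volume B ≤ volume (A + B) := by
  classical
  have hAm : MeasurableSet A := hA.measurableSet
  have hBm : MeasurableSet B := hB.measurableSet
  have hABm : MeasurableSet (A + B) := (hA.add hB).measurableSet
  have hBne : B.Nonempty := ⟨b₀, hb₀⟩
  set s : ℕ → ℝ≥0∞ := fun k => volume (((↑) : ℝ → AddCircle D) '' layer A D k) with hs_def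
  set t : ℕ → ℝ≥0∞ := fun k => volume (((↑) : ℝ → AddCircle D) '' layer (A + B) D k)
    with ht_def
  -- `K = K_A`, the number of non-empty layers of `A`
  obtain ⟨N, hN⟩ := exists_layer_eq_empty (D := D) hA.isBounded
  have hN1 : 1 ≤ N := by
    by_contra h
    have h0 : N = 0 := by omega
    rw [h0, layer_zero] at hN
    exact univ_nonempty.ne_empty hN
  set K := Nat.findGreatest (fun k => (layer A D k).Nonempty) N with hK_def
  have hK1 : 1 ≤ K := Nat.le_findGreatest hN1 (layer_one_nonempty hAne)
  have hKN : K ≤ N := Nat.findGreatest_le N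
  have hKne : (layer A D K).Nonempty :=
    Nat.findGreatest_spec (P := fun k => (layer A D k).Nonempty) hN1 (layer_one_nonempty hAne)
  have hKempty : layer A D (K + 1) = ∅ := by
    by_cases h : K + 1 ≤ N
    · exact not_nonempty_iff_eq_empty.mp
        (Nat.findGreatest_is_greatest (P := fun k => (layer A D k).Nonempty)
          (Nat.lt_succ_self K) h)
    · have hKN' : N ≤ K + 1 := by omega
      exact eq_empty_of_subset_empty (hN ▸ layer_antitone hKN')
  have hne_of_le : ∀ k, k ≤ K → (layer A D k).Nonempty := fun k hk =>
    hKne.mono (layer_antitone hk)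
  have hs_zero : ∀ k, K + 1 ≤ k → s k = 0 := by
    intro k hk
    have h : layer A D k = ∅ := eq_empty_of_subset_empty (hKempty ▸ layer_antitone hk)
    simp only [hs_def, h, image_empty, measure_empty]
  -- layer-cake: `λ(A) = Σ_{k ≤ K} μ(Ã_k)` and `λ(A + B) ≥ Σ_{k ≤ K+1} μ(S̃_k)`
  have hvolA : volume A = ∑ k ∈ Finset.range K, s (k + 1) := by
    rw [volume_eq_tsum_volume_image_layer (D := D) hAm]
    refine tsum_eq_sum (s := Finset.range K) fun k hk => ?_
    rw [Finset.mem_range, not_lt] at hk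
    exact hs_zero (k + 1) (by omega)
  have hvolS : ∑ k ∈ Finset.range (K + 1), t (k + 1) ≤ volume (A + B) := by
    rw [volume_eq_tsum_volume_image_layer (D := D) hABm]
    exact ENNReal.sum_le_tsum _
  -- (4), (3) and monotonicity of the layers of `S`
  have hR : ∀ k, k ≤ K → min (ENNReal.ofReal D) (s k + volume B) ≤ t k := fun k hkK =>
    min_le_volume_image_layer_add hAm hBm hBne hBsub (hne_of_le k hkK)
  have hS : ∀ k, 1 ≤ k → s k ≤ t (k + 1) := fun k hk =>
    volume_image_layer_le_succ hk hb₀ hb₁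
  have hM : ∀ k, 1 ≤ k → t k ≤ t 1 := fun k hk =>
    measure_mono (image_mono (layer_antitone hk))
  by_cases h1 : ENNReal.ofReal D ≤ t 1
  · -- `μ(S̃_1) = D`: `λ(A + B) ≥ D + Σ_{k ≥ 2} μ(S̃_k) ≥ D + Σ_{k ≥ 1} μ(Ã_k) = D + λ(A)`
    left
    calc volume A + ENNReal.ofReal D
        = ENNReal.ofReal D + ∑ k ∈ Finset.range K, s (k + 1) := by rw [hvolA, add_comm]
      _ ≤ t 1 + ∑ k ∈ Finset.range K, t (k + 1 + 1) :=
          add_le_add h1 (Finset.sum_le_sum fun k _ => hS (k + 1) (by omega))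
      _ = ∑ k ∈ Finset.range (K + 1), t (k + 1) := by
          rw [Finset.sum_range_succ' (fun k => t (k + 1)), add_comm]
      _ ≤ volume (A + B) := hvolS
  · -- `μ(S̃_k) ≤ μ(S̃_1) < D`, so (4) reads `μ(Ã_k) + λ(B) ≤ μ(S̃_k)` for `k ≤ K`
    right
    rw [not_le] at h1
    have hR' : ∀ k, 1 ≤ k → k ≤ K → s k + volume B ≤ t k := by
      intro k hk1 hkK
      rcases min_le_iff.mp (hR k hkK) with h' | h'
      · exact absurd (h'.trans (hM k hk1)) (not_le.mpr h1)
      · exact h'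
    have key : volume A + K • volume B + s K ≤ volume (A + B) := by
      calc volume A + K • volume B + s K
          = ∑ k ∈ Finset.range K, (s (k + 1) + volume B) + s K := by
            rw [Finset.sum_add_distrib, Finset.sum_const, Finset.card_range, hvolA]
        _ ≤ ∑ k ∈ Finset.range K, t (k + 1) + t (K + 1) :=
            add_le_add (Finset.sum_le_sum fun k hk =>
              hR' (k + 1) (by omega) (by rw [Finset.mem_range] at hk; omega)) (hS K hK1)
        _ = ∑ k ∈ Finset.range (K + 1), t (k + 1) := by rw [Finset.sum_range_succ]
        _ ≤ volume (A + B) := hvolS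
    rcases Nat.lt_or_ge K 2 with hK2 | hK2
    · -- `K = 1`: `λ(A) = μ(Ã_1)` and `λ(A + B) ≥ λ(A) + λ(B) + μ(Ã_1)`
      left
      have hK : K = 1 := by omega
      have hsA : s 1 = volume A := by rw [hvolA, hK]; simp
      have key1 : volume A + volume B + volume A ≤ volume (A + B) := by
        have h := key
        rw [hK, one_nsmul, hsA] at h
        exact h
      calc 2 * volume A + volume B = volume A + volume B + volume A := by ring
        _ ≤ volume (A + B) := key1
    · -- `K ≥ 2`: `λ(A + B) ≥ λ(A) + K λ(B) ≥ λ(A) + 2 λ(B)`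
      right
      calc volume A + 2 * volume B = volume A + 2 • volume B + 0 := by
            rw [two_nsmul, two_mul, add_zero]
        _ ≤ volume A + K • volume B + s K :=
            add_le_add (add_le_add le_rfl (nsmul_le_nsmul_left bot_le hK2)) bot_le
        _ ≤ volume (A + B) := key

end Core

end RuzsaDiameter

open RuzsaDiameter in
/-- **Ruzsa's diameter inequality** [cite: Ruzsa1991]: for bounded measurable sets
`A, B ⊆ ℝ` with `λ(A) ≤ λ(B)` (and `A ≠ ∅`),
`λ(A + B) ≥ λ(A) + min(diam B, λ(A) + λ(B))` — the statement printed in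
[cite: DeRoton2018, §1, p. 178] ("In [Ruz91], Ruzsa improved on the well-known lower bound
`λ(A + B) ≥ λ(A) + λ(B)` and proved that, if `λ(A) ≤ λ(B)`, this can be replaced by
`λ(A + B) ≥ λ(A) + min(diam(B), λ(A) + λ(B))`") and as display (8) of
[cite: DeRoton2018, §2, Remark 3] ("As noticed by Ruzsa in [Ruz91], when `λ(A) ≤ λ(B)`, (7) also
yields (8)"). Here `volume (A + B)` is Mathlib's (outer) Lebesgue measure of the sumset, which
dominates the inner measure used in the sources, and `Metric.ediam B = sSup B - sInf B = diam B`.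
The hypothesis `A.Nonempty` is necessary (for `A = ∅` the left side is `min (diam B, λ(B))`).

Proof followed: [cite: DeRoton2018, §2, proof of Lemma 1] (fibre layers modulo `D = diam B`,
Raikov's theorem on `ℝ/Dℤ` = `addCircle_min_le_volume_add'`), specialised to `λ(A) ≤ λ(B)`
(`RuzsaDiameter.volume_add_ge_three_cases`), and inner regularity ("the case of general sets can
be obtained by applying the result to some sequences of closed sets `A_n ⊂ A` and `B_n ⊂ B`",
ibid.). -/
theorem volume_add_min_ediam_le_volume_add {A B : Set ℝ} (hA : MeasurableSet A)
    (hB : MeasurableSet B) (hAb : Bornology.IsBounded A) (hBb : Bornology.IsBounded B)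
    (hAne : A.Nonempty) (hle : volume A ≤ volume B) :
    volume A + min (Metric.ediam B) (volume A + volume B) ≤ volume (A + B) := by
  rcases B.eq_empty_or_nonempty with rfl | hBne
  · have h0 : volume A = 0 := le_antisymm (by simpa using hle) bot_le
    simp [h0]
  rw [Real.ediam_eq hBb]
  have hAfin : volume A ≠ ∞ := hAb.measure_lt_top.ne
  have hBfin : volume B ≠ ∞ := hBb.measure_lt_top.ne
  refine ENNReal.le_of_forall_pos_le_add fun ε hε _ => ?_
  -- `η = ε / 3`
  set η : ℝ := (ε : ℝ) / 3 with hη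
  have hη0 : 0 < η := by rw [hη]; positivity
  have hη' : ENNReal.ofReal η ≠ 0 := (ENNReal.ofReal_pos.mpr hη0).ne'
  have h3η : 3 * ENNReal.ofReal η = (ε : ℝ≥0∞) := by
    rw [← ENNReal.ofReal_coe_nnreal, show ((ε : NNReal) : ℝ) = 3 * η by rw [hη]; ring,
      ENNReal.ofReal_mul (by norm_num : (0 : ℝ) ≤ 3), ENNReal.ofReal_ofNat]
  -- a compact `A' ⊆ A` with `λ(A) ≤ λ(A') + η`, non-empty
  obtain ⟨A₁, hA₁A, hA₁c, hA₁⟩ := hA.exists_isCompact_lt_add hAfin hη'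
  obtain ⟨a₀, ha₀⟩ := hAne
  set A' := A₁ ∪ {a₀} with hA'
  have hA'c : IsCompact A' := hA₁c.union isCompact_singleton
  have hA'A : A' ⊆ A := union_subset hA₁A (singleton_subset_iff.mpr ha₀)
  have hA'ne : A'.Nonempty := ⟨a₀, Or.inr rfl⟩
  have hvA : volume A ≤ volume A' + ENNReal.ofReal η :=
    hA₁.le.trans (add_le_add (measure_mono subset_union_left) le_rfl)
  -- a compact `B' ⊆ B` with `λ(B) ≤ λ(B') + η` and `diam B' ≥ diam B - 2η`
  obtain ⟨B₁, hB₁B, hB₁c, hB₁⟩ := hB.exists_isCompact_lt_add hBfin hη'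
  obtain ⟨p, hpB, hp⟩ := Real.lt_sInf_add_pos hBne hη0
  obtain ⟨q, hqB, hq⟩ := Real.add_neg_lt_sSup hBne (neg_lt_zero.mpr hη0)
  set B' := B₁ ∪ {p, q} with hB'
  have hB'c : IsCompact B' := hB₁c.union (Set.toFinite {p, q}).isCompact
  have hpB' : p ∈ B' := Or.inr (Or.inl rfl)
  have hqB' : q ∈ B' := Or.inr (Or.inr rfl)
  have hB'B : B' ⊆ B := by
    refine union_subset hB₁B ?_
    rintro y (rfl | rfl)
    exacts [hpB, hqB]
  have hB'ne : B'.Nonempty := ⟨p, hpB'⟩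
  have hvB : volume B ≤ volume B' + ENNReal.ofReal η :=
    hB₁.le.trans (add_le_add (measure_mono subset_union_left) le_rfl)
  -- normalisation data of `B'`
  set b₀ := sInf B' with hb₀
  set b₁ := sSup B' with hb₁
  have hb₀B' : b₀ ∈ B' := hB'c.sInf_mem hB'ne
  have hb₁B' : b₁ ∈ B' := hB'c.sSup_mem hB'ne
  have hB'sub : B' ⊆ Icc b₀ b₁ := fun y hy =>
    ⟨csInf_le hB'c.bddBelow hy, le_csSup hB'c.bddAbove hy⟩
  have hDD : sSup B - sInf B ≤ (b₁ - b₀) + 2 * η := by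
    have h1 : b₀ ≤ p := csInf_le hB'c.bddBelow hpB'
    have h2 : q ≤ b₁ := le_csSup hB'c.bddAbove hqB'
    linarith
  have hmono : volume (A' + B') ≤ volume (A + B) := measure_mono (add_subset_add hA'A hB'B)
  rcases eq_or_lt_of_le (sub_nonneg.mpr (hB'sub hb₀B').2) with h0 | hDpos
  · -- degenerate period `b₁ = b₀`: then `diam B ≤ 2η` and `λ(A + B) ≥ λ(A' + {b₀}) = λ(A')`
    have hAB : volume A' ≤ volume (A + B) := by
      calc volume A' = volume (A' + {b₀}) := by
            rw [add_singleton, image_add_right, measure_preimage_add_right]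
        _ ≤ volume (A + B) :=
            measure_mono (add_subset_add hA'A (singleton_subset_iff.mpr (hB'B hb₀B')))
    calc volume A + min (ENNReal.ofReal (sSup B - sInf B)) (volume A + volume B)
        ≤ volume A + ENNReal.ofReal (sSup B - sInf B) := add_le_add le_rfl (min_le_left _ _)
      _ ≤ (volume A' + ENNReal.ofReal η) + 2 * ENNReal.ofReal η := by
          refine add_le_add hvA ?_
          calc ENNReal.ofReal (sSup B - sInf B) ≤ ENNReal.ofReal (2 * η) :=
                ENNReal.ofReal_le_ofReal (by linarith)
            _ = 2 * ENNReal.ofReal η := by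
                rw [ENNReal.ofReal_mul (by norm_num : (0 : ℝ) ≤ 2), ENNReal.ofReal_ofNat]
      _ = volume A' + 3 * ENNReal.ofReal η := by ring
      _ ≤ volume (A + B) + ε := by rw [h3η]; exact add_le_add hAB le_rfl
  · -- main case: period `D' = b₁ - b₀ = diam B' > 0`
    haveI : Fact (0 < b₁ - b₀) := ⟨hDpos⟩
    have hb₁' : b₀ + (b₁ - b₀) ∈ B' := by rw [add_sub_cancel]; exact hb₁B'
    have hB'sub' : B' ⊆ Icc b₀ (b₀ + (b₁ - b₀)) := by rw [add_sub_cancel]; exact hB'sub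
    rcases volume_add_ge_three_cases (D := b₁ - b₀) hA'c hA'ne hB'c hb₀B' hb₁' hB'sub'
      with h | h | h
    · -- `λ(A') + diam B' ≤ λ(A' + B')`
      calc volume A + min (ENNReal.ofReal (sSup B - sInf B)) (volume A + volume B)
          ≤ volume A + ENNReal.ofReal (sSup B - sInf B) := add_le_add le_rfl (min_le_left _ _)
        _ ≤ (volume A' + ENNReal.ofReal η)
              + (ENNReal.ofReal (b₁ - b₀) + 2 * ENNReal.ofReal η) := by
            refine add_le_add hvA ?_
            calc ENNReal.ofReal (sSup B - sInf B) ≤ ENNReal.ofReal ((b₁ - b₀) + 2 * η) :=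
                  ENNReal.ofReal_le_ofReal hDD
              _ = ENNReal.ofReal (b₁ - b₀) + 2 * ENNReal.ofReal η := by
                  rw [ENNReal.ofReal_add hDpos.le (by positivity),
                    ENNReal.ofReal_mul (by norm_num : (0 : ℝ) ≤ 2), ENNReal.ofReal_ofNat]
        _ = (volume A' + ENNReal.ofReal (b₁ - b₀)) + 3 * ENNReal.ofReal η := by ring
        _ ≤ volume (A + B) + ε := by rw [h3η]; exact add_le_add (h.trans hmono) le_rfl
    · -- `2 λ(A') + λ(B') ≤ λ(A' + B')`
      calc volume A + min (ENNReal.ofReal (sSup B - sInf B)) (volume A + volume B)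
          ≤ volume A + (volume A + volume B) := add_le_add le_rfl (min_le_right _ _)
        _ ≤ (volume A' + ENNReal.ofReal η)
              + ((volume A' + ENNReal.ofReal η) + (volume B' + ENNReal.ofReal η)) :=
            add_le_add hvA (add_le_add hvA hvB)
        _ = (2 * volume A' + volume B') + 3 * ENNReal.ofReal η := by ring
        _ ≤ volume (A + B) + ε := by rw [h3η]; exact add_le_add (h.trans hmono) le_rfl
    · -- `λ(A') + 2 λ(B') ≤ λ(A' + B')`, together with `λ(A) ≤ λ(B)`
      calc volume A + min (ENNReal.ofReal (sSup B - sInf B)) (volume A + volume B)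
          ≤ volume A + (volume A + volume B) := add_le_add le_rfl (min_le_right _ _)
        _ ≤ volume A + (volume B + volume B) := add_le_add le_rfl (add_le_add hle le_rfl)
        _ ≤ (volume A' + ENNReal.ofReal η)
              + ((volume B' + ENNReal.ofReal η) + (volume B' + ENNReal.ofReal η)) :=
            add_le_add hvA (add_le_add hvB hvB)
        _ = (volume A' + 2 * volume B') + 3 * ENNReal.ofReal η := by ring
        _ ≤ volume (A + B) + ε := by rw [h3η]; exact add_le_add (h.trans hmono) le_rfl

/-- The symmetric case `A = B` of Ruzsa's diameter inequality:
`λ(A + A) ≥ λ(A) + min(diam A, 2λ(A))` for bounded measurable non-empty `A ⊆ ℝ`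
[cite: Ruzsa1991] [cite: DeRoton2018, §2, Remark 3]. -/
theorem volume_add_min_ediam_le_volume_add_self {A : Set ℝ} (hA : MeasurableSet A)
    (hAb : Bornology.IsBounded A) (hAne : A.Nonempty) :
    volume A + min (Metric.ediam A) (volume A + volume A) ≤ volume (A + A) :=
  volume_add_min_ediam_le_volume_add hA hA hAb hAb hAne le_rfl

/-! ### Ruzsa's lemma with the multiplicity `k = K_A` (compact sets) -/

namespace RuzsaDiameter

section Multiplicity

variable {A B : Set ℝ} {D : ℝ}

/-- `K_E`, the largest `k` with `Ẽ_k ≠ ∅`, i.e. the maximal number of elements of `E` in a class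
`x + Dℤ` (de Roton's `K_E = max{k ∈ ℕ | Ẽ_k ≠ ∅}`, Ruzsa's `k` of Lemma 1; meaningful for bounded `E`
and `D > 0`, where the layers are eventually empty) [cite: DeRoton2018, §2, Lemma 1]. -/
noncomputable def maxMult (E : Set ℝ) (D : ℝ) : ℕ := sSup {k : ℕ | (layer E D k).Nonempty}

/-- The indices of non-empty layers of a bounded set are bounded. [folklore] -/
private lemma bddAbove_setOf_layer_nonempty (hA : Bornology.IsBounded A) (hD : 0 < D) :
    BddAbove {k : ℕ | (layer A D k).Nonempty} := by
  obtain ⟨R, hR⟩ := hA.subset_closedBall (0 : ℝ)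
  rw [Real.closedBall_eq_Icc, zero_sub, zero_add] at hR
  refine ⟨⌊2 * R / D⌋₊ + 2, fun k hk => ?_⟩
  by_contra h
  have h' : layer A D k ⊆ layer A D (⌊2 * R / D⌋₊ + 2) := layer_antitone (by omega)
  rw [layer_eq_empty_of_subset_Icc hR hD] at h'
  exact hk.ne_empty (eq_empty_of_subset_empty h')

/-- `Ã_{K_A} ≠ ∅` (bounded `A`, `D > 0`) [cite: DeRoton2018, §2, proof of Lemma 1]. -/
lemma layer_maxMult_nonempty (hA : Bornology.IsBounded A) (hD : 0 < D) :
    (layer A D (maxMult A D)).Nonempty :=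
  Nat.sSup_mem ⟨0, by simp [layer_zero]⟩ (bddAbove_setOf_layer_nonempty hA hD)

/-- `Ã_k = ∅` for `k > K_A` [cite: DeRoton2018, §2, proof of Lemma 1]. -/
lemma layer_eq_empty_of_maxMult_lt (hA : Bornology.IsBounded A) (hD : 0 < D) {k : ℕ}
    (hk : maxMult A D < k) : layer A D k = ∅ := by
  by_contra h
  have hk' : k ≤ maxMult A D :=
    le_csSup (bddAbove_setOf_layer_nonempty hA hD) (nonempty_iff_ne_empty.mpr h)
  omega

/-- `1 ≤ K_A` for `A ≠ ∅` [cite: DeRoton2018, §2, proof of Lemma 1]. -/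
lemma one_le_maxMult (hA : Bornology.IsBounded A) (hD : 0 < D) (hne : A.Nonempty) :
    1 ≤ maxMult A D :=
  le_csSup (bddAbove_setOf_layer_nonempty hA hD) (layer_one_nonempty hne)

/-- `Σ_{k < K} (K − k) = K(K+1)/2`. [folklore] -/
private lemma sum_range_sub_eq (K : ℕ) : ∑ k ∈ Finset.range K, (K - k) = K * (K + 1) / 2 := by
  have h1 : ∑ k ∈ Finset.range (K + 1), (K - k) = ∑ k ∈ Finset.range K, (K - k) := by
    rw [Finset.sum_range_succ, Nat.sub_self, add_zero]
  have h2 : ∑ j ∈ Finset.range (K + 1), (K + 1 - 1 - j) = ∑ j ∈ Finset.range (K + 1), j :=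
    Finset.sum_range_reflect (fun j => j) (K + 1)
  simp only [Nat.add_sub_cancel] at h2
  rw [← h1, h2, Finset.sum_range_id, Nat.add_sub_cancel, mul_comm]

variable [hD : Fact (0 < D)]

/-- **Ruzsa's lemma** [cite: DeRoton2018, §2, Lemma 1] [cite: Ruzsa1991], for compact sets (the
printed proof's setting: "working with the inner Lebesgue measure, we can assume that `A` and `B` are
closed sets") and `B` normalised (`b₀ = min B`, `b₀ + D = max B`, `D = diam B > 0`), with
`k = K_A = maxMult A D`: either (1) `λ(A + B) ≥ λ(A) + diam B`, or
(2) `λ(A + B) ≥ ((k+1)/k) λ(A) + ((k+1)/2) λ(B)`, stated here multiplied through by `k`: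
`k λ(A + B) ≥ (k + 1) λ(A) + (k(k+1)/2) λ(B)`. Proof = displays (3)–(5) ibid.: if `μ(S̃_1) < D` then
`k μ(S̃_j) ≥ (j − 1) μ(Ã_{j−1}) + (k + 1 − j)(μ(Ã_j) + λ(B))` for `1 ≤ j ≤ k + 1`, and one sums. -/
theorem volume_add_ge_maxMult (hA : IsCompact A) (hAne : A.Nonempty) (hB : IsCompact B)
    {b₀ : ℝ} (hb₀ : b₀ ∈ B) (hb₁ : b₀ + D ∈ B) (hBsub : B ⊆ Icc b₀ (b₀ + D)) :
    volume A + ENNReal.ofReal D ≤ volume (A + B) ∨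
      ((maxMult A D + 1 : ℕ) : ℝ≥0∞) * volume A
          + ((maxMult A D * (maxMult A D + 1) / 2 : ℕ) : ℝ≥0∞) * volume B
        ≤ (maxMult A D : ℝ≥0∞) * volume (A + B) := by
  have hAm : MeasurableSet A := hA.measurableSet
  have hBm : MeasurableSet B := hB.measurableSet
  have hABm : MeasurableSet (A + B) := (hA.add hB).measurableSet
  have hBne : B.Nonempty := ⟨b₀, hb₀⟩
  set s : ℕ → ℝ≥0∞ := fun k => volume (((↑) : ℝ → AddCircle D) '' layer A D k) with hs_def
  set t : ℕ → ℝ≥0∞ := fun k => volume (((↑) : ℝ → AddCircle D) '' layer (A + B) D k)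
    with ht_def
  set K := maxMult A D with hK_def
  have hK1 : 1 ≤ K := one_le_maxMult hA.isBounded hD.out hAne
  have hKne : (layer A D K).Nonempty := layer_maxMult_nonempty hA.isBounded hD.out
  have hne_of_le : ∀ k, k ≤ K → (layer A D k).Nonempty := fun k hk =>
    hKne.mono (layer_antitone hk)
  have hs_zero : ∀ k, K + 1 ≤ k → s k = 0 := by
    intro k hk
    have h : layer A D k = ∅ := layer_eq_empty_of_maxMult_lt hA.isBounded hD.out (by omega)
    simp only [hs_def, h, image_empty, measure_empty]
  have hvolA : volume A = ∑ k ∈ Finset.range K, s (k + 1) := by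
    rw [volume_eq_tsum_volume_image_layer (D := D) hAm]
    refine tsum_eq_sum (s := Finset.range K) fun k hk => ?_
    rw [Finset.mem_range, not_lt] at hk
    exact hs_zero (k + 1) (by omega)
  have hvolS : ∑ k ∈ Finset.range (K + 1), t (k + 1) ≤ volume (A + B) := by
    rw [volume_eq_tsum_volume_image_layer (D := D) hABm]
    exact ENNReal.sum_le_tsum _
  have hR : ∀ k, k ≤ K → min (ENNReal.ofReal D) (s k + volume B) ≤ t k := fun k hkK =>
    min_le_volume_image_layer_add hAm hBm hBne hBsub (hne_of_le k hkK)
  have hS : ∀ k, 1 ≤ k → s k ≤ t (k + 1) := fun k hk =>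
    volume_image_layer_le_succ hk hb₀ hb₁
  have hM : ∀ k, 1 ≤ k → t k ≤ t 1 := fun k hk =>
    measure_mono (image_mono (layer_antitone hk))
  by_cases h1 : ENNReal.ofReal D ≤ t 1
  · -- (1): `μ(S̃_1) = D`
    left
    calc volume A + ENNReal.ofReal D
        = ENNReal.ofReal D + ∑ k ∈ Finset.range K, s (k + 1) := by rw [hvolA, add_comm]
      _ ≤ t 1 + ∑ k ∈ Finset.range K, t (k + 1 + 1) :=
          add_le_add h1 (Finset.sum_le_sum fun k _ => hS (k + 1) (by omega))
      _ = ∑ k ∈ Finset.range (K + 1), t (k + 1) := by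
          rw [Finset.sum_range_succ' (fun k => t (k + 1)), add_comm]
      _ ≤ volume (A + B) := hvolS
  · -- (2): the weighted combination (5) of (3) and (4)
    right
    rw [not_le] at h1
    have hR' : ∀ k, 1 ≤ k → k ≤ K → s k + volume B ≤ t k := by
      intro k hk1 hkK
      rcases min_le_iff.mp (hR k hkK) with h' | h'
      · exact absurd (h'.trans (hM k hk1)) (not_le.mpr h1)
      · exact h'
    -- the coefficient `k(k+1)/2 = Σ_{j<k} (k - j)`
    have hC : ((K * (K + 1) / 2 : ℕ) : ℝ≥0∞) = ∑ k ∈ Finset.range K, ((K - k : ℕ) : ℝ≥0∞) := by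
      rw [← sum_range_sub_eq K, Nat.cast_sum]
    calc ((K + 1 : ℕ) : ℝ≥0∞) * volume A + ((K * (K + 1) / 2 : ℕ) : ℝ≥0∞) * volume B
        = ∑ k ∈ Finset.range K, ((K + 1 : ℕ) : ℝ≥0∞) * s (k + 1)
            + ∑ k ∈ Finset.range K, ((K - k : ℕ) : ℝ≥0∞) * volume B := by
          rw [hvolA, Finset.mul_sum, hC, Finset.sum_mul]
      _ = ∑ k ∈ Finset.range K, (((k + 1 : ℕ) : ℝ≥0∞) * s (k + 1)
            + ((K - k : ℕ) : ℝ≥0∞) * (s (k + 1) + volume B)) := by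
          rw [← Finset.sum_add_distrib]
          refine Finset.sum_congr rfl fun k hk => ?_
          rw [Finset.mem_range] at hk
          have e : ((K + 1 : ℕ) : ℝ≥0∞) = ((k + 1 : ℕ) : ℝ≥0∞) + ((K - k : ℕ) : ℝ≥0∞) := by
            norm_cast; omega
          rw [e]; ring
      _ ≤ ∑ k ∈ Finset.range K, (((k + 1 : ℕ) : ℝ≥0∞) * t (k + 1 + 1)
            + ((K - k : ℕ) : ℝ≥0∞) * t (k + 1)) := by
          refine Finset.sum_le_sum fun k hk => ?_
          rw [Finset.mem_range] at hk
          exact add_le_add (mul_le_mul' le_rfl (hS (k + 1) (by omega)))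
            (mul_le_mul' le_rfl (hR' (k + 1) (by omega) (by omega)))
      _ = ∑ k ∈ Finset.range K, ((k + 1 : ℕ) : ℝ≥0∞) * t (k + 1 + 1)
            + ∑ k ∈ Finset.range K, ((K - k : ℕ) : ℝ≥0∞) * t (k + 1) := Finset.sum_add_distrib
      _ = ∑ k ∈ Finset.range (K + 1), ((k : ℕ) : ℝ≥0∞) * t (k + 1)
            + ∑ k ∈ Finset.range (K + 1), ((K - k : ℕ) : ℝ≥0∞) * t (k + 1) := by
          congr 1
          · rw [Finset.sum_range_succ' (fun k => ((k : ℕ) : ℝ≥0∞) * t (k + 1))]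
            simp
          · rw [Finset.sum_range_succ, Nat.sub_self, Nat.cast_zero, zero_mul, add_zero]
      _ = ∑ k ∈ Finset.range (K + 1), (K : ℝ≥0∞) * t (k + 1) := by
          rw [← Finset.sum_add_distrib]
          refine Finset.sum_congr rfl fun k hk => ?_
          rw [Finset.mem_range] at hk
          have e : ((k : ℕ) : ℝ≥0∞) + ((K - k : ℕ) : ℝ≥0∞) = (K : ℝ≥0∞) := by
            norm_cast; omega
          rw [← add_mul, e]
      _ = (K : ℝ≥0∞) * ∑ k ∈ Finset.range (K + 1), t (k + 1) := by rw [Finset.mul_sum]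
      _ ≤ (K : ℝ≥0∞) * volume (A + B) := mul_le_mul' le_rfl hvolS

/-- The discrete minimisation behind Ruzsa's theorem: with `λ(A)/λ(B) = K(K−1)/2 + Kδ`, `0 ≤ δ < 1`,
the sequence `f(k) = ((k+1)/k) λ(A) + ((k+1)/2) λ(B)` is minimal at `k = K`, where
`f(K) = λ(A) + (K + δ) λ(B)`; in cleared form: `k (K + δ) ≤ K(K−1)/2 + Kδ + k(k+1)/2` for every
integer `k`, since the difference is `(K − k)(K − k − 1 + 2δ)/2 ≥ 0`
[cite: DeRoton2018, §2, proof of Theorem 6] ("As noticed by Ruzsa, the sequence `(f(k))` is non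
increasing for `k ≤ K` and increasing for `k ≥ K`"). -/
lemma mul_add_le_of_ratio (K k : ℕ) {δ : ℝ} (hδ0 : 0 ≤ δ) (hδ1 : δ < 1) :
    (k : ℝ) * (K + δ) ≤ (K : ℝ) * ((K : ℝ) - 1) / 2 + K * δ + (k : ℝ) * ((k : ℝ) + 1) / 2 := by
  have key : 0 ≤ ((K : ℝ) - k) * ((K : ℝ) - k - 1 + 2 * δ) := by
    rcases lt_trichotomy k K with h | h | h
    · have h1 : (1 : ℝ) ≤ (K : ℝ) - k := by
        have : k + 1 ≤ K := h
        have : ((k + 1 : ℕ) : ℝ) ≤ K := by exact_mod_cast this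
        push_cast at this; linarith
      exact mul_nonneg (by linarith) (by linarith)
    · subst h; simp
    · have h1 : (K : ℝ) - k ≤ -1 := by
        have : K + 1 ≤ k := h
        have : ((K + 1 : ℕ) : ℝ) ≤ k := by exact_mod_cast this
        push_cast at this; linarith
      exact mul_nonneg_of_nonpos_of_nonpos (by linarith) (by linarith)
  nlinarith [key]

/-- **Ruzsa's theorem, compact sets** [cite: Ruzsa1991] as printed in
[cite: DeRoton2018, §1, Theorem 4] and [cite: DeRoton2018, §2, Theorem 6, (7)]: let `A, B` be compact,
`A ≠ ∅`, `B` normalised (`b₀ = min B`, `b₀ + D = max B ∈ B`, `D = diam B > 0`), and let `K ∈ ℕ*`,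
`δ ∈ [0, 1)` be defined by `λ(A)/λ(B) = K(K−1)/2 + Kδ` (here: `λ(A) = (K(K−1)/2 + Kδ) λ(B)`). Then
either `λ(A + B) ≥ λ(A) + diam B` or `λ(A + B) ≥ λ(A) + (K + δ) λ(B)` (7); in particular
`λ(A + B) ≥ λ(A) + min(diam B, (K + δ) λ(B))` (Theorem 4). From `volume_add_ge_maxMult` and
`mul_add_le_of_ratio` (`f(K_A) ≥ f(K)`). Real-valued (`volume.real`; all sets are bounded).
-- TODO(general form): non-closed bounded sets (inner measure), and de Roton's improvement for
-- `diam A / diam B ≤ K` [cite: DeRoton2018, §2, Theorem 6, second display]. -/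
theorem volume_add_ge_ratio (hA : IsCompact A) (hAne : A.Nonempty) (hB : IsCompact B)
    {b₀ : ℝ} (hb₀ : b₀ ∈ B) (hb₁ : b₀ + D ∈ B) (hBsub : B ⊆ Icc b₀ (b₀ + D))
    {K : ℕ} {δ : ℝ} (hδ0 : 0 ≤ δ) (hδ1 : δ < 1)
    (hratio : volume.real A = ((K : ℝ) * ((K : ℝ) - 1) / 2 + K * δ) * volume.real B) :
    volume.real A + D ≤ volume.real (A + B) ∨
      volume.real A + (K + δ) * volume.real B ≤ volume.real (A + B) := by
  have hAfin : volume A ≠ ∞ := hA.isBounded.measure_lt_top.ne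
  have hBfin : volume B ≠ ∞ := hB.isBounded.measure_lt_top.ne
  have hSfin : volume (A + B) ≠ ∞ := (hA.add hB).isBounded.measure_lt_top.ne
  rcases volume_add_ge_maxMult hA hAne hB hb₀ hb₁ hBsub with h | h
  · left
    have h' := (ENNReal.toReal_le_toReal (by finiteness) hSfin).mpr h
    rw [ENNReal.toReal_add hAfin ENNReal.ofReal_ne_top, ENNReal.toReal_ofReal hD.out.le] at h'
    exact h'
  · right
    set k := maxMult A D with hk
    have hk1 : 1 ≤ k := one_le_maxMult hA.isBounded hD.out hAne
    -- pass to real numbers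
    have h' := (ENNReal.toReal_le_toReal (by finiteness) (by finiteness)).mpr h
    rw [ENNReal.toReal_add (by finiteness) (by finiteness), ENNReal.toReal_mul, ENNReal.toReal_mul,
      ENNReal.toReal_mul] at h'
    simp only [ENNReal.toReal_natCast] at h'
    -- `h' : (k+1) a + (k(k+1)/2 : ℕ) b ≤ k S` (as reals)
    have hdiv : (((k * (k + 1) / 2 : ℕ) : ℝ)) = (k : ℝ) * ((k : ℝ) + 1) / 2 := by
      have h2 : 2 ∣ k * (k + 1) := (Nat.even_mul_succ_self k).two_dvd
      rw [Nat.cast_div h2 (by norm_num)]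
      push_cast
      ring
    rw [hdiv] at h'
    have hb0 : 0 ≤ volume.real B := measureReal_nonneg
    have hkey := mul_add_le_of_ratio K k hδ0 hδ1
    -- `k (a + (K+δ) b) ≤ (k+1) a + k(k+1)/2 b ≤ k S`, divide by `k ≥ 1`
    have hk0 : (0 : ℝ) < k := by exact_mod_cast hk1
    have step : (k : ℝ) * (volume.real A + (K + δ) * volume.real B)
        ≤ ((k : ℝ) + 1) * volume.real A + (k : ℝ) * ((k : ℝ) + 1) / 2 * volume.real B := by
      rw [hratio]
      nlinarith [mul_le_mul_of_nonneg_right hkey hb0, hb0]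
    have : (k : ℝ) * (volume.real A + (K + δ) * volume.real B) ≤ (k : ℝ) * volume.real (A + B) := by
      refine step.trans ?_
      have e : ((k : ℝ) + 1) * volume.real A + (k : ℝ) * ((k : ℝ) + 1) / 2 * volume.real B
          = ((k + 1 : ℕ) : ℝ) * volume.real A + (k : ℝ) * ((k : ℝ) + 1) / 2 * volume.real B := by
        push_cast; ring
      rw [e]; exact h'
    exact le_of_mul_le_mul_left this hk0

end Multiplicity

end RuzsaDiameter

/-! ### The diameter of the smaller set, and the continuous `3k − 4` diameter bounds -/

open RuzsaDiameter in
/-- **Ruzsa's inequality with the diameter of the smaller set**: for bounded measurable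
`A, B ⊆ ℝ`, `A ≠ ∅`, `λ(A) ≤ λ(B)`: `λ(A + B) ≥ λ(B) + min(diam A, 2λ(A))`. This is the case
`K' ≥ 2` of Ruzsa's theorem applied to `(B, A)` [cite: DeRoton2018, §2, proof of Theorem 1 (i)]
("On the other hand `λ(B)/λ(A) = K'(K'−1)/2 + K'δ'` with `K' ≥ 2` … and Theorem 6 yields
`diam(A) ≤ λ(A+B) − λ(B)`") [cite: Ruzsa1991]; here from `RuzsaDiameter.volume_add_ge_three_cases`
with the roles of `A` and `B` exchanged (`2λ(B) + λ(A) ≥ λ(B) + 2λ(A)` when `λ(A) ≤ λ(B)`) and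
inner regularity. -/
theorem volume_add_min_ediam_le_volume_add' {A B : Set ℝ} (hA : MeasurableSet A)
    (hB : MeasurableSet B) (hAb : Bornology.IsBounded A) (hBb : Bornology.IsBounded B)
    (hAne : A.Nonempty) (hle : volume A ≤ volume B) :
    volume B + min (Metric.ediam A) (2 * volume A) ≤ volume (A + B) := by
  rcases B.eq_empty_or_nonempty with rfl | hBne
  · have h0 : volume A = 0 := le_antisymm (by simpa using hle) bot_le
    simp [h0]
  rw [Real.ediam_eq hAb]
  have hAfin : volume A ≠ ∞ := hAb.measure_lt_top.ne
  have hBfin : volume B ≠ ∞ := hBb.measure_lt_top.ne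
  refine ENNReal.le_of_forall_pos_le_add fun ε hε _ => ?_
  set η : ℝ := (ε : ℝ) / 3 with hη
  have hη0 : 0 < η := by rw [hη]; positivity
  have hη' : ENNReal.ofReal η ≠ 0 := (ENNReal.ofReal_pos.mpr hη0).ne'
  have h3η : 3 * ENNReal.ofReal η = (ε : ℝ≥0∞) := by
    rw [← ENNReal.ofReal_coe_nnreal, show ((ε : NNReal) : ℝ) = 3 * η by rw [hη]; ring,
      ENNReal.ofReal_mul (by norm_num : (0 : ℝ) ≤ 3), ENNReal.ofReal_ofNat]
  -- a compact `B' ⊆ B` with `λ(B) ≤ λ(B') + η`, non-empty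
  obtain ⟨B₁, hB₁B, hB₁c, hB₁⟩ := hB.exists_isCompact_lt_add hBfin hη'
  obtain ⟨b, hb⟩ := hBne
  set B' := B₁ ∪ {b} with hB'
  have hB'c : IsCompact B' := hB₁c.union isCompact_singleton
  have hB'B : B' ⊆ B := union_subset hB₁B (singleton_subset_iff.mpr hb)
  have hB'ne : B'.Nonempty := ⟨b, Or.inr rfl⟩
  have hvB : volume B ≤ volume B' + ENNReal.ofReal η :=
    hB₁.le.trans (add_le_add (measure_mono subset_union_left) le_rfl)
  -- a compact `A' ⊆ A` with `λ(A) ≤ λ(A') + η` and `diam A' ≥ diam A - 2η`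
  obtain ⟨A₁, hA₁A, hA₁c, hA₁⟩ := hA.exists_isCompact_lt_add hAfin hη'
  obtain ⟨p, hpA, hp⟩ := Real.lt_sInf_add_pos hAne hη0
  obtain ⟨q, hqA, hq⟩ := Real.add_neg_lt_sSup hAne (neg_lt_zero.mpr hη0)
  set A' := A₁ ∪ {p, q} with hA'
  have hA'c : IsCompact A' := hA₁c.union (Set.toFinite {p, q}).isCompact
  have hpA' : p ∈ A' := Or.inr (Or.inl rfl)
  have hqA' : q ∈ A' := Or.inr (Or.inr rfl)
  have hA'A : A' ⊆ A := by
    refine union_subset hA₁A ?_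
    rintro y (rfl | rfl)
    exacts [hpA, hqA]
  have hA'ne : A'.Nonempty := ⟨p, hpA'⟩
  have hvA : volume A ≤ volume A' + ENNReal.ofReal η :=
    hA₁.le.trans (add_le_add (measure_mono subset_union_left) le_rfl)
  -- normalisation data of `A'`
  set a₀ := sInf A' with ha₀
  set a₁ := sSup A' with ha₁
  have ha₀A' : a₀ ∈ A' := hA'c.sInf_mem hA'ne
  have ha₁A' : a₁ ∈ A' := hA'c.sSup_mem hA'ne
  have hA'sub : A' ⊆ Icc a₀ a₁ := fun y hy =>
    ⟨csInf_le hA'c.bddBelow hy, le_csSup hA'c.bddAbove hy⟩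
  have hDD : sSup A - sInf A ≤ (a₁ - a₀) + 2 * η := by
    have h1 : a₀ ≤ p := csInf_le hA'c.bddBelow hpA'
    have h2 : q ≤ a₁ := le_csSup hA'c.bddAbove hqA'
    linarith
  have hmono : volume (B' + A') ≤ volume (A + B) := by
    rw [add_comm]; exact measure_mono (add_subset_add hA'A hB'B)
  rcases eq_or_lt_of_le (sub_nonneg.mpr (hA'sub ha₀A').2) with h0 | hDpos
  · -- degenerate: `a₁ = a₀`, so `diam A ≤ 2η`, and `λ(A + B) ≥ λ(B' + {a₀}) = λ(B')`
    have hAB : volume B' ≤ volume (A + B) := by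
      calc volume B' = volume (B' + {a₀}) := by
            rw [add_singleton, image_add_right, measure_preimage_add_right]
        _ ≤ volume (A + B) := by
            rw [add_comm A B]
            exact measure_mono (add_subset_add hB'B (singleton_subset_iff.mpr (hA'A ha₀A')))
    calc volume B + min (ENNReal.ofReal (sSup A - sInf A)) (2 * volume A)
        ≤ volume B + ENNReal.ofReal (sSup A - sInf A) := add_le_add le_rfl (min_le_left _ _)
      _ ≤ (volume B' + ENNReal.ofReal η) + 2 * ENNReal.ofReal η := by
          refine add_le_add hvB ?_
          calc ENNReal.ofReal (sSup A - sInf A) ≤ ENNReal.ofReal (2 * η) :=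
                ENNReal.ofReal_le_ofReal (by linarith)
            _ = 2 * ENNReal.ofReal η := by
                rw [ENNReal.ofReal_mul (by norm_num : (0 : ℝ) ≤ 2), ENNReal.ofReal_ofNat]
      _ = volume B' + 3 * ENNReal.ofReal η := by ring
      _ ≤ volume (A + B) + ε := by rw [h3η]; exact add_le_add hAB le_rfl
  · -- main case: period `a₁ - a₀ = diam A' > 0`, Ruzsa's lemma for `(B', A')`
    haveI : Fact (0 < a₁ - a₀) := ⟨hDpos⟩
    have ha₁' : a₀ + (a₁ - a₀) ∈ A' := by rw [add_sub_cancel]; exact ha₁A'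
    have hA'sub' : A' ⊆ Icc a₀ (a₀ + (a₁ - a₀)) := by rw [add_sub_cancel]; exact hA'sub
    rcases volume_add_ge_three_cases (D := a₁ - a₀) hB'c hB'ne hA'c ha₀A' ha₁' hA'sub'
      with h | h | h
    · -- `λ(B') + diam A' ≤ λ(B' + A')`
      calc volume B + min (ENNReal.ofReal (sSup A - sInf A)) (2 * volume A)
          ≤ volume B + ENNReal.ofReal (sSup A - sInf A) := add_le_add le_rfl (min_le_left _ _)
        _ ≤ (volume B' + ENNReal.ofReal η)
              + (ENNReal.ofReal (a₁ - a₀) + 2 * ENNReal.ofReal η) := by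
            refine add_le_add hvB ?_
            calc ENNReal.ofReal (sSup A - sInf A) ≤ ENNReal.ofReal ((a₁ - a₀) + 2 * η) :=
                  ENNReal.ofReal_le_ofReal hDD
              _ = ENNReal.ofReal (a₁ - a₀) + 2 * ENNReal.ofReal η := by
                  rw [ENNReal.ofReal_add hDpos.le (by positivity),
                    ENNReal.ofReal_mul (by norm_num : (0 : ℝ) ≤ 2), ENNReal.ofReal_ofNat]
        _ = (volume B' + ENNReal.ofReal (a₁ - a₀)) + 3 * ENNReal.ofReal η := by ring
        _ ≤ volume (A + B) + ε := by rw [h3η]; exact add_le_add (h.trans hmono) le_rfl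
    · -- `2 λ(B') + λ(A') ≤ λ(B' + A')`, with `λ(A) ≤ λ(B)`
      calc volume B + min (ENNReal.ofReal (sSup A - sInf A)) (2 * volume A)
          ≤ volume B + 2 * volume A := add_le_add le_rfl (min_le_right _ _)
        _ = volume B + (volume A + volume A) := by rw [two_mul]
        _ ≤ volume B + (volume B + volume A) := add_le_add le_rfl (add_le_add hle le_rfl)
        _ ≤ (volume B' + ENNReal.ofReal η)
              + ((volume B' + ENNReal.ofReal η) + (volume A' + ENNReal.ofReal η)) :=
            add_le_add hvB (add_le_add hvB hvA)
        _ = (2 * volume B' + volume A') + 3 * ENNReal.ofReal η := by ring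
        _ ≤ volume (A + B) + ε := by rw [h3η]; exact add_le_add (h.trans hmono) le_rfl
    · -- `λ(B') + 2 λ(A') ≤ λ(B' + A')`
      calc volume B + min (ENNReal.ofReal (sSup A - sInf A)) (2 * volume A)
          ≤ volume B + 2 * volume A := add_le_add le_rfl (min_le_right _ _)
        _ = volume B + (volume A + volume A) := by rw [two_mul]
        _ ≤ (volume B' + ENNReal.ofReal η)
              + ((volume A' + ENNReal.ofReal η) + (volume A' + ENNReal.ofReal η)) :=
            add_le_add hvB (add_le_add hvA hvA)
        _ = (volume B' + 2 * volume A') + 3 * ENNReal.ofReal η := by ring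
        _ ≤ volume (A + B) + ε := by rw [h3η]; exact add_le_add (h.trans hmono) le_rfl

/-- **Continuous `3k − 4` theorem, the two diameter bounds**
[cite: DeRoton2018, §1, Theorem 1 (i), first two items]: for bounded measurable non-empty
`A, B ⊆ ℝ` with `λ(A + B) < λ(A) + λ(B) + min(λ(A), λ(B))`: `diam A ≤ λ(A + B) − λ(B)` and
`diam B ≤ λ(A + B) − λ(A)`, stated additively in `ℝ≥0∞` (the printed hypothesis
`λ(A), λ(B) ≠ 0` is implied by the smallness hypothesis for non-empty sets). "The first two
statements under hypothesis (i) are a straightforward application of Ruzsa's results in [Ruz91]"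
(ibid.): from `volume_add_min_ediam_le_volume_add` and `volume_add_min_ediam_le_volume_add'`.
The third item of Theorem 1 (an interval of length `λ(A) + λ(B)` inside `A + B`) and
hypothesis (ii) are NOT here. -/
theorem ediam_add_volume_le_of_small_sumset {A B : Set ℝ} (hA : MeasurableSet A)
    (hB : MeasurableSet B) (hAb : Bornology.IsBounded A) (hBb : Bornology.IsBounded B)
    (hAne : A.Nonempty) (hBne : B.Nonempty)
    (hsmall : volume (A + B) < volume A + volume B + min (volume A) (volume B)) :
    Metric.ediam A + volume B ≤ volume (A + B) ∧ Metric.ediam B + volume A ≤ volume (A + B) := by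
  wlog hle : volume A ≤ volume B generalizing A B
  · have hle' : volume B ≤ volume A := le_of_not_ge hle
    have hsmall' : volume (B + A) < volume B + volume A + min (volume B) (volume A) := by
      rw [add_comm B A, add_comm (volume B) (volume A), min_comm]; exact hsmall
    have h := this hB hA hBb hAb hBne hAne hsmall' hle'
    rw [add_comm B A] at h
    exact ⟨h.2, h.1⟩
  rw [min_eq_left hle] at hsmall
  have h1 := volume_add_min_ediam_le_volume_add hA hB hAb hBb hAne hle
  have h2 := volume_add_min_ediam_le_volume_add' hA hB hAb hBb hAne hle
  constructor
  · rcases le_total (Metric.ediam A) (2 * volume A) with h | h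
    · rw [min_eq_left h] at h2; rw [add_comm]; exact h2
    · rw [min_eq_right h] at h2
      exfalso
      have h3 : volume A + volume B + volume A ≤ volume (A + B) := by
        calc volume A + volume B + volume A = volume B + 2 * volume A := by ring
          _ ≤ _ := h2
      exact absurd (h3.trans_lt hsmall) (lt_irrefl _)
  · rcases le_total (Metric.ediam B) (volume A + volume B) with h | h
    · rw [min_eq_left h] at h1; rw [add_comm]; exact h1
    · rw [min_eq_right h] at h1
      exfalso
      have h3 : volume A + volume B + volume A ≤ volume (A + B) := by
        calc volume A + volume B + volume A = volume A + (volume A + volume B) := by ring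
          _ ≤ _ := h1
      exact absurd (h3.trans_lt hsmall) (lt_irrefl _)

/-! ### de Roton's switch lemma -/

/-- **Method of switches** [cite: DeRoton2018, §3, Lemma 2, first item]: for measurable
`A, B ⊆ ℝ` and `x ∉ A + B` (printed for `x ≥ 0`; trivial for `x < 0`):
`λ([0, x] ∩ A) + λ([0, x] ∩ B) ≤ x` ("large density of
`A` and `B` on `[0, x]` forces `x` to belong to `A + B`"). Proof as printed: for `t ∈ [0, x]`
either `t ∉ B` or `x − t ∉ A`, so `[0, x] ∩ B` and `[0, x] ∩ (x − A)` are disjoint subsets of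
`[0, x]`, and `t ↦ x − t` preserves Lebesgue measure. (The printed normalisation
`inf A = inf B = 0` is not needed for this item; the second item, near `D_A + D_B`, is NOT here.) -/
theorem volume_inter_add_volume_inter_le_of_notMem_add {A B : Set ℝ} (hA : MeasurableSet A)
    (hB : MeasurableSet B) {x : ℝ} (hxAB : x ∉ A + B) :
    volume (Icc 0 x ∩ A) + volume (Icc 0 x ∩ B) ≤ ENNReal.ofReal x := by
  -- the reflection `t ↦ x - t`
  have hrefl : volume ((fun t => x - t) ⁻¹' (Icc 0 x ∩ A)) = volume (Icc 0 x ∩ A) :=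
    (Measure.measurePreserving_sub_left volume x).measure_preimage
      (measurableSet_Icc.inter hA).nullMeasurableSet
  have hpre : (fun t => x - t) ⁻¹' (Icc 0 x ∩ A) = Icc 0 x ∩ (fun t => x - t) ⁻¹' A := by
    ext t
    simp only [mem_preimage, mem_inter_iff, mem_Icc]
    constructor
    · rintro ⟨⟨h1, h2⟩, h3⟩; exact ⟨⟨by linarith, by linarith⟩, h3⟩
    · rintro ⟨⟨h1, h2⟩, h3⟩; exact ⟨⟨by linarith, by linarith⟩, h3⟩
  have hdisj : Disjoint (Icc 0 x ∩ (fun t => x - t) ⁻¹' A) (Icc 0 x ∩ B) := by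
    rw [Set.disjoint_left]
    rintro t ⟨_, htA⟩ ⟨_, htB⟩
    exact hxAB (Set.mem_add.mpr ⟨x - t, htA, t, htB, by ring⟩)
  calc volume (Icc 0 x ∩ A) + volume (Icc 0 x ∩ B)
      = volume (Icc 0 x ∩ (fun t => x - t) ⁻¹' A) + volume (Icc 0 x ∩ B) := by
        rw [← hrefl, hpre]
    _ = volume ((Icc 0 x ∩ (fun t => x - t) ⁻¹' A) ∪ (Icc 0 x ∩ B)) :=
        (measure_union hdisj (measurableSet_Icc.inter hB)).symm
    _ ≤ volume (Icc 0 x) := measure_mono (union_subset inter_subset_left inter_subset_left)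
    _ = ENNReal.ofReal x := by rw [Real.volume_Icc, sub_zero]

end Literature.Combinatorics.Additive
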